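import Literature.NumberTheory.EllipticCurves.Gamma0EisensteinWeightOneRows
import Literature.NumberTheory.EllipticCurves.EisensteinWeightOneLatticeLimit
import Mathlib.Analysis.Complex.CauchyIntegral
import Mathlib.Analysis.Complex.Convex
import HarnessLib

/-!
# Hecke's weight-one Eisenstein series at `s = 0`: continuation, automorphy, value

Topic `Literature/NumberTheory/EllipticCurves`; namespace
`Literature.NumberTheory.EllipticCurves.ModularForms`. Definitions with bodies (`rowPoint`,
`eisensteinOneCont`) and theorems; no named fact.

For an odd Dirichlet character `χ` mod `M` and `z ∈ ℍ` put

  `G̃(z, s) = 2 yˢ ( L(χ, 1 + 2s) + ∑_{n ≥ 0} R̃(χℤ, M(n+1) z, s) )`       (`eisensteinOneCont`)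

with the continued rows `R̃` of `EisensteinWeightOneRowContinuation.lean`. We prove:

* `eisensteinOneCont_eq_eisensteinOneAll` — `G̃ = G` (the sum over all pairs `M ∣ c`) on
  `Re s > 1/2`, hence `eisensteinOneCont_eq_LFunction_mul` — **`G̃(z, s) = L(χ, 1+2s) E₁,χ(z, s)`**
  there (`Gamma0EisensteinWeightOneAllPairs/Rows`);
* `differentiableOn_eisensteinOneCont` — **`s ↦ G̃(z, s)` is holomorphic on `Re s > -1/2`**: the
  rows are dominated on boxes by `C ((M(n+1)y)^{-2-2a} + (M(n+1)y)^{-2-2b})`, summable for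
  `a > -1/2` (`norm_rowCont_le`, the antitonicity of `a ↦ ∫(1+v²)^{-a/2}`), and `L(χ, ·)` is entire
  for `χ ≠ 1`;
* `eisensteinOneCont_smul` — **automorphy for ALL `Re s > -1/2`**:
  `χ(d) G̃(Az, s) = (cz + d) G̃(z, s)` for `A = (a b; c d) ∈ Γ₀(M)`, by the identity theorem from
  the region of absolute convergence (`eisensteinOne_smul`); `eisensteinOneCont_T_zpow_smul`;
* `eisensteinOneCont_zero` — **the value at `s = 0`**:
  `G̃(z, 0) = 2 L(χ, 1) + 2 ∑_{n ≥ 0} ∑_{r mod M} χ(r) (π/M) cot(π((n+1) z + r/M))`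
  (`rowCont_zero_eq`, Hecke's limit formula), a holomorphic function of `z` whose `q`-expansion
  (next file) is `2 L(χ, 1) - (4πi τ(χ)/M) ∑_{m ≥ 1} (∑_{d ∣ m} χ̄(d)) qᵐ`.

So `z ↦ G̃(z, 0)/(2 L(χ, 1))` is Hecke's holomorphic Eisenstein series of weight one and character
`χ̄` on `Γ₀(M)` with constant term `1` at `∞` (Hecke 1927, Satz; Schoeneberg VII §3; Miyake
Thm 7.2.13), obtained here by "Hecke's trick" `s → 0`.

## References

* E. Hecke, *Theorie der Eisensteinschen Reihen höherer Stufe und ihre Anwendung auf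
  Funktionentheorie und Arithmetik*, Abh. Math. Sem. Hamburg 5 (1927), §§1–3.
* B. Schoeneberg, *Elliptic Modular Functions*, Springer (1974), Ch. VII §§2–3.
* T. Miyake, *Modular Forms*, Springer (1989), §7.2.
-/

noncomputable section

open Complex UpperHalfPlane Filter MeasureTheory Set CongruenceSubgroup
open scoped Topology Real MatrixGroups

namespace Literature.NumberTheory.EllipticCurves.ModularForms

variable {M : ℕ} (χ : DirichletCharacter ℂ M)

/-! ### The objects -/

/-- The base point `M(n+1) z` of the `n`-th positive row. [folklore] -/
def rowPoint (M : ℕ) (n : ℕ) (z : ℍ) : ℂ := (((M : ℤ) * ((n : ℤ) + 1) : ℤ) : ℂ) * z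

/-- `Im (M(n+1) z) = M (n+1) Im z`. [folklore] -/
theorem rowPoint_im (M : ℕ) (n : ℕ) (z : ℍ) : (rowPoint M n z).im = M * ((n : ℝ) + 1) * z.im := by
  unfold rowPoint
  rw [show ((((M : ℤ) * ((n : ℤ) + 1) : ℤ) : ℂ)) = (((M : ℝ) * ((n : ℝ) + 1) : ℝ) : ℂ) by
    push_cast; ring, Complex.im_ofReal_mul]
  rfl

/-- The row base points lie in `ℍ` (`M > 0`). [folklore] -/
theorem rowPoint_im_pos (hM : 0 < M) (n : ℕ) (z : ℍ) : 0 < (rowPoint M n z).im := by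
  rw [rowPoint_im]
  have : (0 : ℝ) < M := by exact_mod_cast hM
  exact mul_pos (by positivity) z.im_pos

/-- `Im (M(n+1) z) ≥ M y`. [folklore] -/
theorem rowPoint_im_ge (n : ℕ) (z : ℍ) : (M : ℝ) * z.im ≤ (rowPoint M n z).im := by
  rw [rowPoint_im]
  have h1 : (1 : ℝ) ≤ (n : ℝ) + 1 := by simp
  have := z.im_pos.le
  nlinarith [mul_nonneg (Nat.cast_nonneg M) this]

variable [NeZero M]

/-- **Hecke's continued weight-one Eisenstein sum**
`G̃(z, s) = 2 yˢ (L(χ, 1 + 2s) + ∑_{n ≥ 0} R̃(χℤ, M(n+1) z, s))`. [folklore] -/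
def eisensteinOneCont (z : ℍ) (s : ℂ) : ℂ :=
  2 * ((z.im : ℝ) : ℂ) ^ s *
    (χ.LFunction (1 + 2 * s) + ∑' n : ℕ, rowCont M (chiZ χ) (rowPoint M n z) s)

/-! ### Agreement with the absolutely convergent sums on `Re s > 1/2` -/

/-- **`G̃ = G` on `Re s > 1/2`** (odd `χ`). [folklore] -/
theorem eisensteinOneCont_eq_eisensteinOneAll (hodd : χ.Odd) {s : ℂ} (hs : 1 / 2 < s.re)
    (z : ℍ) : eisensteinOneCont χ z s = eisensteinOneAll χ z s := by
  rw [eisensteinOneAll_eq_rowCont χ hodd hs z]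
  unfold eisensteinOneCont rowPoint
  ring

/-- **`G̃(z, s) = L(χ, 1 + 2s) · E₁,χ(z, s)` on `Re s > 1/2`** (odd `χ`). [folklore] -/
theorem eisensteinOneCont_eq_LFunction_mul (hodd : χ.Odd) {s : ℂ} (hs : 1 / 2 < s.re)
    (z : ℍ) : eisensteinOneCont χ z s = χ.LFunction (1 + 2 * s) * eisensteinOne χ z s := by
  rw [eisensteinOneCont_eq_eisensteinOneAll χ hodd hs z, eisensteinOneAll_eq_LFunction_mul χ hs z]

/-! ### Holomorphy on `Re s > -1/2` -/

/-- `a ↦ ∫ (1+v²)^{-a/2}` is antitone (for `a > 1`, where the integrals converge). [folklore] -/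
theorem integral_one_add_sq_rpow_antitone {a b : ℝ} (ha : 1 < a) (hab : a ≤ b) :
    ∫ v : ℝ, (1 + v ^ 2) ^ (-b / 2) ≤ ∫ v : ℝ, (1 + v ^ 2) ^ (-a / 2) := by
  refine integral_mono_of_nonneg (Eventually.of_forall fun v ↦ Real.rpow_nonneg (by positivity) _)
    (integrable_one_add_sq_rpow ha) (Eventually.of_forall fun v ↦ ?_)
  exact Real.rpow_le_rpow_of_exponent_le (by nlinarith [sq_nonneg v]) (by linarith)

/-- The two-exponent domination `η^{-2-2σ} ≤ η^{-2-2a} + η^{-2-2b}` on `a < σ < b` (`η > 0`).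
[folklore] -/
theorem rpow_neg_two_sub_le {η a b σ : ℝ} (hη : 0 < η) (ha : a < σ) (hb : σ < b) :
    η ^ (-2 - 2 * σ) ≤ η ^ (-2 - 2 * a) + η ^ (-2 - 2 * b) := by
  rcases le_or_gt η 1 with h1 | h1
  · have : η ^ (-2 - 2 * σ) ≤ η ^ (-2 - 2 * b) :=
      Real.rpow_le_rpow_of_exponent_ge hη h1 (by linarith)
    linarith [Real.rpow_nonneg hη.le (-2 - 2 * a)]
  · have : η ^ (-2 - 2 * σ) ≤ η ^ (-2 - 2 * a) :=
      Real.rpow_le_rpow_of_exponent_le h1.le (by linarith)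
    linarith [Real.rpow_nonneg hη.le (-2 - 2 * b)]

omit [NeZero M] in
/-- `∑_n (M(n+1)y)^{-p} < ∞` for `p > 1`. [folklore] -/
theorem summable_rowPoint_im_rpow (hM : 0 < M) (z : ℍ) {p : ℝ} (hp : 1 < p) :
    Summable fun n : ℕ ↦ (rowPoint M n z).im ^ (-p) := by
  have hMy : 0 < (M : ℝ) * z.im := mul_pos (by exact_mod_cast hM) z.im_pos
  have h := ((Real.summable_one_div_nat_add_rpow 1 p).mpr hp).mul_left (((M : ℝ) * z.im) ^ (-p))
  refine h.congr fun n ↦ ?_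
  rw [rowPoint_im, show (M : ℝ) * ((n : ℝ) + 1) * z.im = ((M : ℝ) * z.im) * ((n : ℝ) + 1) by ring,
    Real.mul_rpow hMy.le (by positivity)]
  congr 1
  rw [abs_of_pos (by positivity), Real.rpow_neg (by positivity), one_div]

/-- **The row series is holomorphic on boxes** `a < Re s < b`, `|Im s| < T` with `-1/2 < a`.
[folklore] -/
theorem differentiableOn_tsum_rowCont_box (z : ℍ) {a b T : ℝ} (ha : -1 / 2 < a)
    (hab : a < b) (hT : 0 < T) :
    DifferentiableOn ℂ (fun s ↦ ∑' n : ℕ, rowCont M (chiZ χ) (rowPoint M n z) s)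
      {s : ℂ | a < s.re ∧ s.re < b ∧ |s.im| < T} := by
  have hM : 0 < M := Nat.pos_of_ne_zero (NeZero.ne M)
  have hUo : IsOpen {s : ℂ | a < s.re ∧ s.re < b ∧ |s.im| < T} :=
    (isOpen_lt continuous_const Complex.continuous_re).inter
      ((isOpen_lt Complex.continuous_re continuous_const).inter
        (isOpen_lt (continuous_abs.comp Complex.continuous_im) continuous_const))
  -- constants
  set B : ℝ := 4 * M * ∑ i ∈ Finset.range M, ‖chiZ χ i‖ with hB
  set S : ℝ := |a| + |b| + T with hS
  set I : ℝ := ∫ v : ℝ, (1 + v ^ 2) ^ (-(3 + 2 * a) / 2) with hI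
  have hI0 : 0 ≤ I := integral_nonneg fun v ↦ Real.rpow_nonneg (by positivity) _
  set K : ℝ := B * (10 * (1 + S) ^ 2 * Real.exp (2 * π * T) * I) with hK
  have hK0 : 0 ≤ K := by positivity
  have hsum : Summable fun n : ℕ ↦
      K * ((rowPoint M n z).im ^ (-2 - 2 * a) + (rowPoint M n z).im ^ (-2 - 2 * b)) := by
    refine Summable.mul_left K (Summable.add ?_ ?_)
    · simpa [show -(2 + 2 * a) = -2 - 2 * a by ring] using
        summable_rowPoint_im_rpow hM z (p := 2 + 2 * a) (by linarith)
    · simpa [show -(2 + 2 * b) = -2 - 2 * b by ring] using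
        summable_rowPoint_im_rpow hM z (p := 2 + 2 * b) (by linarith)
  refine differentiableOn_tsum_of_summable_norm hsum (fun n ↦ ?_) hUo (fun n s hs ↦ ?_)
  · intro s hs
    exact (differentiableAt_rowCont hM (chiZ χ) (rowPoint_im_pos hM n z)
      (by simp only [Set.mem_setOf_eq] at hs; linarith [hs.1])).differentiableWithinAt
  · obtain ⟨hsa, hsb, hsT⟩ := hs
    have hs1 : -1 < s.re := by linarith
    have hη := rowPoint_im_pos hM n z
    refine (norm_rowCont_le hM (chiZ χ) hη hs1).trans ?_
    rw [← hB]
    have hsn : ‖s‖ ≤ S := by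
      calc ‖s‖ ≤ |s.re| + |s.im| := Complex.norm_le_abs_re_add_abs_im s
        _ ≤ (|a| + |b|) + T := by
            refine add_le_add ?_ hsT.le
            rcases le_or_gt 0 s.re with h | h
            · rw [abs_of_nonneg h]; linarith [le_abs_self b, abs_nonneg a]
            · rw [abs_of_neg h]; linarith [neg_le_abs a, abs_nonneg b]
        _ = S := by rw [hS]
    have hexp : Real.exp (2 * π * |s.im|) ≤ Real.exp (2 * π * T) :=
      Real.exp_le_exp.mpr (by nlinarith [Real.pi_pos, hsT.le])
    have hIs : ∫ v : ℝ, (1 + v ^ 2) ^ (-(3 + 2 * s.re) / 2) ≤ I :=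
      integral_one_add_sq_rpow_antitone (by linarith) (by linarith)
    have hIs0 : 0 ≤ ∫ v : ℝ, (1 + v ^ 2) ^ (-(3 + 2 * s.re) / 2) :=
      integral_nonneg fun v ↦ Real.rpow_nonneg (by positivity) _
    have hpow := rpow_neg_two_sub_le hη hsa hsb
    have hB0 : 0 ≤ B := by positivity
    calc B * (10 * (1 + ‖s‖) ^ 2 * Real.exp (2 * π * |s.im|) *
          (∫ v : ℝ, (1 + v ^ 2) ^ (-(3 + 2 * s.re) / 2)) * (rowPoint M n z).im ^ (-2 - 2 * s.re))
        ≤ B * (10 * (1 + S) ^ 2 * Real.exp (2 * π * T) * I *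
          ((rowPoint M n z).im ^ (-2 - 2 * a) + (rowPoint M n z).im ^ (-2 - 2 * b))) := by
          refine mul_le_mul_of_nonneg_left ?_ hB0
          refine mul_le_mul ?_ hpow (Real.rpow_nonneg hη.le _) (by positivity)
          refine mul_le_mul ?_ hIs hIs0 (by positivity)
          refine mul_le_mul ?_ hexp (by positivity) (by positivity)
          nlinarith [norm_nonneg s, hsn]
      _ = K * ((rowPoint M n z).im ^ (-2 - 2 * a) + (rowPoint M n z).im ^ (-2 - 2 * b)) := by
          rw [hK]; ring

/-- **The row series is holomorphic on `Re s > -1/2`.** [folklore] -/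
theorem differentiableOn_tsum_rowCont (z : ℍ) :
    DifferentiableOn ℂ (fun s ↦ ∑' n : ℕ, rowCont M (chiZ χ) (rowPoint M n z) s)
      {s : ℂ | -1 / 2 < s.re} := by
  intro s₀ hs₀
  simp only [Set.mem_setOf_eq] at hs₀
  set a : ℝ := (-1 / 2 + s₀.re) / 2 with ha
  set b : ℝ := s₀.re + 1 with hb
  set T : ℝ := |s₀.im| + 1 with hT
  have ha' : -1 / 2 < a := by rw [ha]; linarith
  have hab : a < b := by rw [ha, hb]; linarith
  have hT' : 0 < T := by rw [hT]; positivity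
  have hmem : s₀ ∈ {s : ℂ | a < s.re ∧ s.re < b ∧ |s.im| < T} :=
    ⟨by rw [ha]; linarith, by rw [hb]; linarith, by rw [hT]; linarith⟩
  have hUo : IsOpen {s : ℂ | a < s.re ∧ s.re < b ∧ |s.im| < T} :=
    (isOpen_lt continuous_const Complex.continuous_re).inter
      ((isOpen_lt Complex.continuous_re continuous_const).inter
        (isOpen_lt (continuous_abs.comp Complex.continuous_im) continuous_const))
  exact ((differentiableOn_tsum_rowCont_box χ z ha' hab hT').differentiableAt
    (hUo.mem_nhds hmem)).differentiableWithinAt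

/-- **`s ↦ G̃(z, s)` is holomorphic on `Re s > -1/2`** (for `χ ≠ 1`, e.g. `χ` odd). [folklore] -/
theorem differentiableOn_eisensteinOneCont (hχ : χ ≠ 1) (z : ℍ) :
    DifferentiableOn ℂ (eisensteinOneCont χ z) {s : ℂ | -1 / 2 < s.re} := by
  have hy : ((z.im : ℝ) : ℂ) ≠ 0 := by exact_mod_cast z.im_pos.ne'
  have h1 : Differentiable ℂ fun s : ℂ ↦ 2 * ((z.im : ℝ) : ℂ) ^ s :=
    (differentiable_const _).mul (differentiable_id.const_cpow (Or.inl hy))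
  have h2 : Differentiable ℂ fun s : ℂ ↦ χ.LFunction (1 + 2 * s) :=
    (DirichletCharacter.differentiable_LFunction hχ).comp
      ((differentiable_const _).add ((differentiable_const _).mul differentiable_id))
  unfold eisensteinOneCont
  exact h1.differentiableOn.mul (h2.differentiableOn.add (differentiableOn_tsum_rowCont χ z))

/-! ### Automorphy on `Re s > -1/2` by the identity theorem -/

/-- **Automorphy of the continuation**: for `A = (a b; c d) ∈ Γ₀(M)`, odd `χ`, and every `s` with
`Re s > -1/2`, `χ(d) G̃(Az, s) = (cz + d) G̃(z, s)` (identity theorem from `Re s > 1/2`, where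
`G̃ = L(χ, 1+2s) E₁,χ` and `E₁,χ` is automorphic by reindexing). [folklore] -/
theorem eisensteinOneCont_smul (hodd : χ.Odd) {A : SL(2, ℤ)} (hA : A ∈ Gamma0 M) (z : ℍ)
    {s : ℂ} (hs : -1 / 2 < s.re) :
    χ (A 1 1) * eisensteinOneCont χ (A • z) s = denom A z * eisensteinOneCont χ z s := by
  have hχ := ne_one_of_odd χ hodd
  set U : Set ℂ := {s : ℂ | -1 / 2 < s.re} with hU
  have hUo : IsOpen U := isOpen_lt continuous_const Complex.continuous_re
  have hUc : IsPreconnected U := (convex_halfSpace_re_gt (-1 / 2)).isPreconnected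
  set f : ℂ → ℂ := fun s ↦
    χ (A 1 1) * eisensteinOneCont χ (A • z) s - denom A z * eisensteinOneCont χ z s with hf
  have hfd : DifferentiableOn ℂ f U :=
    ((differentiableOn_const _).mul (differentiableOn_eisensteinOneCont χ hχ (A • z))).sub
      ((differentiableOn_const _).mul (differentiableOn_eisensteinOneCont χ hχ z))
  have hfa : AnalyticOnNhd ℂ f U := hfd.analyticOnNhd hUo
  -- `f = 0` near `s = 1`
  have h1U : (1 : ℂ) ∈ U := by
    simp only [hU, Set.mem_setOf_eq, Complex.one_re]; norm_num
  have hV : {s : ℂ | 1 / 2 < s.re} ∈ 𝓝 (1 : ℂ) :=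
    (isOpen_lt continuous_const Complex.continuous_re).mem_nhds (by
      simp only [Set.mem_setOf_eq, Complex.one_re]; norm_num)
  have hf0 : f =ᶠ[𝓝 1] 0 := by
    filter_upwards [hV] with t ht
    simp only [hf, Pi.zero_apply]
    rw [eisensteinOneCont_eq_LFunction_mul χ hodd ht, eisensteinOneCont_eq_LFunction_mul χ hodd ht,
      mul_left_comm, eisensteinOne_smul χ hA z t]
    ring
  have h := hfa.eqOn_zero_of_preconnected_of_eventuallyEq_zero hUc h1U hf0 hs
  simp only [hf, Pi.zero_apply] at h
  exact sub_eq_zero.mp h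

/-- `G̃(z + n, s) = G̃(z, s)` on `Re s > -1/2`. [folklore] -/
theorem eisensteinOneCont_T_zpow_smul (hodd : χ.Odd) (n : ℤ) (z : ℍ) {s : ℂ}
    (hs : -1 / 2 < s.re) :
    eisensteinOneCont χ (ModularGroup.T ^ n • z) s = eisensteinOneCont χ z s := by
  have e10 : (ModularGroup.T ^ n : SL(2, ℤ)) 1 0 = 0 := by
    rw [ModularGroup.coe_T_zpow]; rfl
  have e11 : (ModularGroup.T ^ n : SL(2, ℤ)) 1 1 = 1 := by
    rw [ModularGroup.coe_T_zpow]; rfl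
  have hT : ModularGroup.T ^ n ∈ Gamma0 M := by
    rw [Gamma0_mem, e10, Int.cast_zero]
  have h := eisensteinOneCont_smul χ hodd hT z hs
  simp only [ModularGroup.denom_apply, e10, e11, Int.cast_zero, zero_mul, zero_add, Int.cast_one,
    map_one, one_mul] at h
  exact h

/-! ### The value at `s = 0` -/

omit [NeZero M] in
/-- The class points of the `n`-th row: `(M(n+1)z + r)/M = (n+1) z + r/M`. [folklore] -/
theorem rowPoint_add_div (hM : 0 < M) (n : ℕ) (z : ℍ) (r : ℤ) :
    (rowPoint M n z + r) / M = ((n : ℂ) + 1) * z + (r : ℂ) / M := by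
  have hM' : (M : ℂ) ≠ 0 := by exact_mod_cast hM.ne'
  unfold rowPoint
  push_cast
  field_simp

/-- **The value at `s = 0`**:
`G̃(z, 0) = 2 (L(χ, 1) + ∑_{n ≥ 0} ∑_{r mod M} χ(r) (π/M) cot(π((n+1) z + r/M)))` for odd `χ`
(Hecke's limit formula row by row, `rowCont_zero_eq`). [folklore] -/
theorem eisensteinOneCont_zero (hodd : χ.Odd) (z : ℍ) :
    eisensteinOneCont χ z 0 = 2 * (χ.LFunction 1 + ∑' n : ℕ, ∑ r : Fin M,
      chiZ χ r * ((π / M) * Complex.cot (π * (((n : ℂ) + 1) * z + ((r : ℕ) : ℂ) / M)))) := by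
  have hM : 0 < M := Nat.pos_of_ne_zero (NeZero.ne M)
  have hχ := ne_one_of_odd χ hodd
  unfold eisensteinOneCont
  rw [cpow_zero, mul_one, mul_zero, add_zero]
  congr 2
  refine tsum_congr fun n ↦ ?_
  rw [rowCont_zero_eq hM (rowPoint_im_pos hM n z) (chiZ_periodic χ) (sum_range_chiZ_eq_zero χ hχ)]
  refine Finset.sum_congr rfl fun r _ ↦ ?_
  rw [rowPoint_add_div hM n z]
  push_cast
  ring_nf

end Literature.NumberTheory.EllipticCurves.ModularForms
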